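import Mathlib.NumberTheory.Padics.Complex
import Mathlib.RingTheory.PowerSeries.Exp
import Mathlib.RingTheory.PowerSeries.Substitution
import HarnessLib

/-!
# Dwork's splitting function: the definitions (decomposition of `Dwork.dworkLifting`)

Part of the bottom-up proof of Dwork's rationality theorem
(`Literature/NumberTheory/LFunctions/DworkRationality.lean`). The last named fact in its trust
base, `Literature.NumberTheory.LFunctions.Dwork.dworkLifting`
(`…/DworkRationalityMeromorphy.lean`: existence of an overconvergent series `G` lifting the
additive character sum `ε^{Tr(x₀ f(x))}` through Teichmüller points), is proved in the sibling
files `…/DworkRationalityDworkLemma.lean`, `…/DworkRationalitySplittingSeries.lean`,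
`…/DworkRationalitySplittingValues.lean`, `…/DworkRationalityTeichmuller.lean` and
`…/DworkRationalityLiftingProofs.lean`. This file only fixes the four objects those files talk
about:

* `Dwork.ahLog p = ∑_{i ≥ 0} X^{pⁱ}/pⁱ ∈ ℚ_p⟦X⟧` and the **Artin–Hasse exponential**
  `Dwork.artinHasse p = exp(∑_{i ≥ 0} X^{pⁱ}/pⁱ)` (Koblitz, GTM 58, Ch. IV §2, p. 93,
  `E_p(X)`; Lang, *Cyclotomic Fields I and II*, Ch. 14 §2, Thm. 2.1), whose membership in `ℤ_p⟦X⟧` ("Dwork's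
  lemma", Koblitz IV.2) is the source of all `p`-adic estimates;
* `Dwork.dworkExp p = exp(X + Xᵖ/p) ∈ ℚ_p⟦X⟧`, so that Dwork's splitting function is
  `θ(X) = dworkExp(πX)` for `π^{p-1} = -p` (`πᵖ/p = -π`);
* `Dwork.splitting p π = exp(π(X - Xᵖ)) ∈ ℂ_p⟦X⟧`, **Dwork's splitting function** `θ`
  (Dwork, Amer. J. Math. 82 (1960), §4, in the form given by Lang, *Cyclotomic Fields I and II*,
  Ch. 14 §2–§3, and Koblitz, Ch. V §2 where the equivalent `Θ = F(X, λ)` is used): for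
  `π^{p-1} = -p` it converges on a disc of radius `> 1`, `θ(1) = ε` is a primitive `p`-th root of
  unity, and `θ(t)θ(tᵖ)⋯θ(t^{p^{N-1}}) = ε^{Tr t̄}` at Teichmüller points `t^{p^N} = t`;
* `Dwork.evalOne p F z = ∑ₙ Fₙ zⁿ`, the value of a one-variable series at a point of `ℂ_p`
  (an unconditional sum; it agrees with `Dwork.evalAt` of `…/DworkRationalityMeromorphy.lean`
  on `ℂ_p⟦X⟧ = MvPowerSeries Unit ℂ_p`, see `…/DworkRationalitySplittingValues.lean`).

## References

* B. Dwork, *On the rationality of the zeta function of an algebraic variety*, Amer. J. Math. 82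
  (1960), 631–648, §4. [Dwork1960]
* N. Koblitz, *p-adic Numbers, p-adic Analysis, and Zeta-Functions*, 2nd ed., GTM 58 (1984),
  Ch. IV §2 (Artin–Hasse exponential, Dwork's lemma), Ch. V §2. [Koblitz1984]
* S. Lang, *Cyclotomic Fields I and II*, GTM 121 (1990), Ch. 14 §2 (the Artin–Hasse power
  series, Thm. 2.1 `AH(X) ∈ ℤ_p⟦X⟧`, Lemma (Dieudonné–Dwork), estimate (1) for `exp(x + xᵖ/p)`,
  Dwork's power series `E_π(X) = exp(πX - πXᵖ)`, Lemma 2.2) and §3 (Thm. 3.2 (Dwork):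
  `E_π(1)` is a primitive `p`-th root of unity; Thm. 3.3). [Lang1990]

## Design notes

* Everything is defined over `ℚ_p` (where `ℤ_p`-integrality and reduction modulo `p` are
  available) and transported to `ℂ_p` by `PowerSeries.map (algebraMap ℚ_[p] ℂ_[p])`, an isometry
  on coefficients.
* `splitting` is *defined* as `exp(π(X - Xᵖ))` (a substitution into `PowerSeries.exp`), for every
  `π`; the factorisation `θ = dworkExp(πX) = AH(πX) · exp(-∑_{i ≥ 2} (πX)^{pⁱ}/pⁱ)` for
  `π^{p-1} = -p` is a theorem of the sibling files.
-/

open PowerSeries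

noncomputable section

namespace Literature.NumberTheory.LFunctions

namespace Dwork

variable (p : ℕ) [Fact p.Prime]

/-- The **Artin–Hasse logarithm** `∑_{i ≥ 0} X^{pⁱ}/pⁱ ∈ ℚ_p⟦X⟧`: the coefficient of `Xⁿ` is
`1/n` if `n` is a power of `p` and `0` otherwise (Koblitz, Ch. IV §2, the exponent of
`E_p(X) = exp(X + Xᵖ/p + X^{p²}/p² + ⋯)`). [cite: Koblitz1984, Ch. IV §2] -/
def ahLog : ℚ_[p]⟦X⟧ :=
  open Classical in
  PowerSeries.mk fun n => if ∃ i : ℕ, n = p ^ i then ((n : ℚ_[p]))⁻¹ else 0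

/-- The **Artin–Hasse exponential** `E_p(X) = exp(∑_{i ≥ 0} X^{pⁱ}/pⁱ) ∈ ℚ_p⟦X⟧` (Koblitz,
Ch. IV §2, p. 93; it lies in `ℤ_p⟦X⟧` by Dwork's lemma). [cite: Koblitz1984, Ch. IV §2] -/
def artinHasse : ℚ_[p]⟦X⟧ := (exp ℚ_[p]).subst (ahLog p)

/-- **Dwork's exponential** `exp(X + Xᵖ/p) ∈ ℚ_p⟦X⟧`, the first two terms of the Artin–Hasse
exponent; Dwork's splitting function is its rescaling `θ(X) = exp(πX + (πX)ᵖ/p) = exp(π(X - Xᵖ))`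
for `π^{p-1} = -p` (Lang, *Cyclotomic Fields I and II*, Ch. 14 §2, estimate (1) and the display
before Lemma 2.2; Koblitz, Ch. V §2). [cite: Lang1990, Ch. 14 §2] -/
def dworkExp : ℚ_[p]⟦X⟧ :=
  (exp ℚ_[p]).subst (X + C ((p : ℚ_[p])⁻¹) * X ^ p)

/-- **Dwork's splitting function** `θ_π(X) = exp(π(X - Xᵖ)) ∈ ℂ_p⟦X⟧` attached to `π ∈ ℂ_p`
(used for `π^{p-1} = -p`): Dwork, Amer. J. Math. 82 (1960), §4; Lang, *Cyclotomic Fields I and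
II*, Ch. 14 §2, "Dwork's power series `E_π(X) = exp(πX - πXᵖ)`" and Lemma 2.2; equivalent to
Koblitz's `Θ(T) = F(T, λ)`, Ch. V §2. [cite: Dwork1960, §4] [cite: Lang1990, Ch. 14 §2 Lemma 2.2] -/
def splitting (π : ℂ_[p]) : ℂ_[p]⟦X⟧ :=
  (exp ℂ_[p]).subst (C π * (X - X ^ p))

/-- The value `F(z) = ∑ₙ Fₙ zⁿ ∈ ℂ_p` of a one-variable power series at a point (an unconditional
sum; junk value `0` when the family is not summable — it is summable for overconvergent `F` and
`‖z‖ ≤ 1`; Koblitz, Ch. IV §1). [cite: Koblitz1984, Ch. IV §1] -/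
def evalOne (F : ℂ_[p]⟦X⟧) (z : ℂ_[p]) : ℂ_[p] :=
  ∑' n : ℕ, coeff n F * z ^ n

variable {p}

open Classical in
/-- The coefficients of the Artin–Hasse logarithm. [cite: Koblitz1984, Ch. IV §2] -/
theorem coeff_ahLog (n : ℕ) :
    coeff n (ahLog p) = if ∃ i : ℕ, n = p ^ i then ((n : ℚ_[p]))⁻¹ else 0 :=
  coeff_mk _ _

/-- The coefficient of `X^{pⁱ}` in the Artin–Hasse logarithm is `p^{-i}`. [cite: Koblitz1984, Ch. IV §2] -/
theorem coeff_ahLog_pow (i : ℕ) : coeff (p ^ i) (ahLog p) = ((p : ℚ_[p]) ^ i)⁻¹ := by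
  rw [coeff_ahLog, if_pos ⟨i, rfl⟩, Nat.cast_pow]

/-- The Artin–Hasse logarithm has no constant term (`0` is not a power of `p`). [cite: Koblitz1984, Ch. IV §2] -/
@[simp] theorem constantCoeff_ahLog : constantCoeff (ahLog p) = 0 := by
  rw [← coeff_zero_eq_constantCoeff_apply, coeff_ahLog, if_neg]
  rintro ⟨i, hi⟩
  exact absurd hi.symm (pow_ne_zero i (Fact.out : p.Prime).ne_zero)

/-- The linear coefficient of the Artin–Hasse logarithm is `1` (`1 = p⁰`). [cite: Koblitz1984, Ch. IV §2] -/
theorem coeff_one_ahLog : coeff 1 (ahLog p) = 1 := by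
  rw [coeff_ahLog, if_pos ⟨0, (pow_zero p).symm⟩, Nat.cast_one, inv_one]

/-- The exponent `X + Xᵖ/p` of Dwork's exponential has no constant term. [folklore] -/
theorem constantCoeff_dworkExp_arg :
    constantCoeff (X + C ((p : ℚ_[p])⁻¹) * X ^ p : ℚ_[p]⟦X⟧) = 0 := by
  rw [map_add, map_mul, constantCoeff_X, map_pow, constantCoeff_X,
    zero_pow (Fact.out : p.Prime).ne_zero, mul_zero, add_zero]

/-- The exponent `π(X - Xᵖ)` of the splitting function has no constant term. [folklore] -/
theorem constantCoeff_splitting_arg (π : ℂ_[p]) :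
    constantCoeff (C π * (X - X ^ p) : ℂ_[p]⟦X⟧) = 0 := by
  rw [map_mul, map_sub, constantCoeff_X, map_pow, constantCoeff_X,
    zero_pow (Fact.out : p.Prime).ne_zero, sub_zero, mul_zero]

/-- `evalOne` unfolds to the unconditional sum `∑ₙ Fₙ zⁿ`. [folklore] -/
theorem evalOne_def (F : ℂ_[p]⟦X⟧) (z : ℂ_[p]) : evalOne p F z = ∑' n : ℕ, coeff n F * z ^ n := rfl

end Dwork

end Literature.NumberTheory.LFunctions
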